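import Summits.HodgeConjecture.CorCM.CMSixfoldRank.DefectNullSets
import HarnessLib

/-!
# Rank of CM types on twelve embeddings, III: classes of points with equal values

Third file of the proof that a primitive CM type on `12` embeddings has rank `≥ 6`
(`RankAtLeastSix.lean`).  For a "value map" `o : E → V` into a `ℚ`-vector space (in the application
`V = Dual M`, `o x = (μ ↦ μ(x))` for Kubota's defect space `M`) with `o(ρx) = −o(x)`, `o x ≠ 0` and
`o x = o y ↔ o(gx) = o(gy)`, the fibres `F(x) = {y | o y = o x}` are the classes of points at which all weights of
`M` agree: they are permuted by `G`, `F(ρx) = ρF(x)` is disjoint from `F(x)`, all have one size, classes with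
values `≠ ±o(x)` are disjoint from `F(x) ⊔ F(ρx)`, `|Φ ∩ F(x)| + |Φ ∩ F(ρx)| = |F(x)|`, and a weight of `M` is
constant on each fibre.  One- and two-term relations `Σ c_j μ(v_j) = 0` identify values.  For a two-element fibre
`{v, v'}` the contribution of its class to `Σ_Φ μ` is `(ε(v) + ε(v'))μ(v)`, `ε = ±1` the sign of membership; the
weight `δ = 𝟙_v + 𝟙_{v'} − 𝟙_{ρv} − 𝟙_{ρv'}` is anti-invariant, balanced as soon as every translate is MIXED at
`{v, v'}`, orthogonal to the `δ` of a disjoint class, and non-zero.  Finally: if `F(x₁) ⊔ F(ρx₁) = E`, or if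
`E` is two classes of size six, then `dim M ≤ 1` (`μ ↦ μ(x₁)` is injective on `M`).  Everything PROVED; no
definition, no named fact.

## References (held texts)

* B. Dodson, *On the Mumford–Tate group of an abelian variety with complex multiplication*, J. Algebra 111 (1987)
  [Dodson1987] (`paper:doi-10-1016-0021-8693-87-90242-0`), p0003 Thm. 1.0, Thm. 1.4; p0004 Cor. 1.5.
* T. Kubota, Trans. AMS 118 (1965) [Kubota1965], §4 (defect).  K. A. Ribet, Mém. SMF 2 (1980) [Ribet1980], §3 (3.5).
* B. B. Gordon, *A survey of the Hodge conjecture for abelian varieties* [Gordon1999HodgeAVSurvey], §9.2 (9.2.1), 9.4.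
-/

noncomputable section

open scoped BigOperators Pointwise Classical

namespace Summit.HodgeConjecture.CorCM.CMSixfoldRank

open Literature.NumberTheory.ComplexMultiplication
open Literature.NumberTheory.ComplexMultiplication.IsCMTypeWith

variable {G : Type*} [Group G] {E : Type*} [MulAction G E]

variable {ρ : G} {Φ : Set E} (h : IsCMTypeWith ρ Φ)
include h

/-! ### Classes of points taking the same values

For the non-separating case we use a "value map" `o : E → V` into a `ℚ`-vector space (`V = Dual M`,
`o x = (μ ↦ μ x)`): `o(ρx) = −o(x)`, `o x ≠ 0`, and `o x = o y ↔ o(gx) = o(gy)`; its fibres `F x = {y | o y = o x}`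
are the classes. -/

section Values

variable {V : Type*} [AddCommGroup V] [Module ℚ V]

omit h in
/-- No value `o x` of the value map is its own negative (`o x ≠ 0` in the `ℚ`-space `V`). [folklore] -/
theorem apply_ne_neg_apply (o : E → V) (ho0 : ∀ x, o x ≠ 0) (x : E) : o x ≠ -o x := by
  intro hx
  have h2 : (2 : ℚ) • o x = 0 := by
    rw [two_smul]
    nth_rewrite 2 [hx]
    exact add_neg_cancel _
  exact ho0 x ((smul_eq_zero.1 h2).resolve_left (by norm_num))

omit h [AddCommGroup V] [Module ℚ V] in
/-- Fibres are translated by the group: `F(gx) = g • F(x)`. [folklore] -/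
theorem fibre_smul (o : E → V) (hoG : ∀ (g : G) (x y : E), o (g • x) = o (g • y) ↔ o x = o y)
    (F : E → Finset E) (hF : ∀ x y, y ∈ F x ↔ o y = o x) (g : G) (x : E) :
    F (g • x) = (F x).image fun y => g • y := by
  ext y
  simp only [Finset.mem_image, hF]
  constructor
  · intro hy
    refine ⟨g⁻¹ • y, (hoG g _ x).1 (by rwa [smul_inv_smul]), smul_inv_smul g y⟩
  · rintro ⟨z, hz, rfl⟩
    exact (hoG g z x).2 hz

omit [Module ℚ V] in
/-- `F(ρx) = ρ • F(x)`. [folklore] -/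
theorem fibre_rho (o : E → V) (hoρ : ∀ x, o (ρ • x) = -o x) (F : E → Finset E)
    (hF : ∀ x y, y ∈ F x ↔ o y = o x) (x : E) : F (ρ • x) = (F x).image fun y => ρ • y := by
  ext y
  simp only [Finset.mem_image, hF, hoρ]
  constructor
  · intro hy
    refine ⟨ρ • y, ?_, h.invol y⟩
    rw [hoρ, hy, neg_neg]
  · rintro ⟨z, hz, rfl⟩
    rw [hoρ, hz]

omit h in
/-- `F(x)` and `F(ρx)` are disjoint (no `o x` vanishes). [folklore] -/
theorem disjoint_fibre_rho (o : E → V) (hoρ : ∀ x, o (ρ • x) = -o x) (ho0 : ∀ x, o x ≠ 0)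
    (F : E → Finset E) (hF : ∀ x y, y ∈ F x ↔ o y = o x) (x : E) : Disjoint (F x) (F (ρ • x)) := by
  rw [Finset.disjoint_left]
  intro y hy hy'
  rw [hF] at hy hy'
  rw [hoρ, hy] at hy'
  exact apply_ne_neg_apply o ho0 x hy'

omit h [AddCommGroup V] [Module ℚ V] in
/-- All fibres have the same size (transitivity). [folklore] -/
theorem card_fibre_eq [MulAction.IsPretransitive G E] (o : E → V)
    (hoG : ∀ (g : G) (x y : E), o (g • x) = o (g • y) ↔ o x = o y)
    (F : E → Finset E) (hF : ∀ x y, y ∈ F x ↔ o y = o x) (x y : E) : (F y).card = (F x).card := by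
  obtain ⟨g, rfl⟩ := MulAction.exists_smul_eq G x y
  rw [fibre_smul o hoG F hF g x, Finset.card_image_of_injective _ (MulAction.injective g)]

/-- The class `F(x) ⊔ F(ρx)` has `2|F(x)|` elements. [folklore] -/
theorem card_union_fibre (o : E → V) (hoρ : ∀ x, o (ρ • x) = -o x) (ho0 : ∀ x, o x ≠ 0)
    (F : E → Finset E) (hF : ∀ x y, y ∈ F x ↔ o y = o x) (x : E) :
    (F x ∪ F (ρ • x)).card = 2 * (F x).card := by
  rw [Finset.card_union_of_disjoint (disjoint_fibre_rho o hoρ ho0 F hF x), fibre_rho h o hoρ F hF x,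
    Finset.card_image_of_injective _ (MulAction.injective ρ)]
  ring

omit h [Module ℚ V] in
/-- Membership in a class `F(x) ⊔ F(ρx)`: `o y = ± o x`. [folklore] -/
theorem mem_union_fibre_iff (o : E → V) (hoρ : ∀ x, o (ρ • x) = -o x) (F : E → Finset E)
    (hF : ∀ x y, y ∈ F x ↔ o y = o x) (x y : E) : y ∈ F x ∪ F (ρ • x) ↔ o y = o x ∨ o y = -o x := by
  rw [Finset.mem_union, hF, hF, hoρ]

omit h [Module ℚ V] in
/-- Classes of points with different values (up to sign) are disjoint. [folklore] -/
theorem disjoint_union_fibre (o : E → V) (hoρ : ∀ x, o (ρ • x) = -o x) (F : E → Finset E)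
    (hF : ∀ x y, y ∈ F x ↔ o y = o x) {x z : E} (hz : o z ≠ o x) (hz' : o z ≠ -o x) :
    Disjoint (F z ∪ F (ρ • z)) (F x ∪ F (ρ • x)) := by
  rw [Finset.disjoint_left]
  intro y hy hy'
  rw [mem_union_fibre_iff o hoρ F hF] at hy hy'
  rcases hy with hy | hy <;> rcases hy' with hy' | hy'
  · exact hz (hy ▸ hy')
  · exact hz' (hy ▸ hy')
  · exact hz' (by rw [← neg_neg (o z), ← hy, hy'])
  · exact hz (by rw [← neg_neg (o z), ← hy, hy', neg_neg])

omit h [AddCommGroup V] [Module ℚ V] in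
/-- A weight of `M` is constant on a fibre: `Σ_{A ∩ F(x)} μ = |A ∩ F(x)| · μ(x)`. [folklore] -/
theorem sum_inter_fibre (M : Submodule ℚ (E → ℚ)) (o : E → V) (hoM : ∀ x y, o y = o x → ∀ μ ∈ M, μ y = μ x)
    (F : E → Finset E) (hF : ∀ x y, y ∈ F x ↔ o y = o x) (A : Finset E) (x : E) {μ : E → ℚ}
    (hμ : μ ∈ M) : ∑ y ∈ A ∩ F x, μ y = ((A ∩ F x).card : ℚ) * μ x := by
  rw [Finset.sum_congr rfl fun y hy => hoM x y ((hF x y).1 (Finset.mem_inter.1 hy).2) μ hμ,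
    Finset.sum_const, nsmul_eq_mul]

omit [Module ℚ V] in
/-- `|Φ ∩ F(x)| + |Φ ∩ F(ρx)| = |F(x)|`: of each pair `y, ρy` (`y ∈ F(x)`) exactly one lies in `Φ`. [folklore] -/
theorem card_inter_fibre_add [Fintype E] (o : E → V) (hoρ : ∀ x, o (ρ • x) = -o x) (F : E → Finset E)
    (hF : ∀ x y, y ∈ F x ↔ o y = o x) (x : E) :
    ((Finset.univ.filter fun y : E => y ∈ Φ) ∩ F x).card +
      ((Finset.univ.filter fun y : E => y ∈ Φ) ∩ F (ρ • x)).card = (F x).card := by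
  have h1 : (Finset.univ.filter fun y : E => y ∈ Φ) ∩ F x = (F x).filter fun y => y ∈ Φ := by
    ext y; simp only [Finset.mem_inter, Finset.mem_filter, Finset.mem_univ, true_and]; tauto
  have h2 : (Finset.univ.filter fun y : E => y ∈ Φ) ∩ F (ρ • x) =
      ((F x).filter fun y => y ∉ Φ).image fun y => ρ • y := by
    rw [fibre_rho h o hoρ F hF x]
    ext y
    simp only [Finset.mem_inter, Finset.mem_filter, Finset.mem_univ, true_and, Finset.mem_image]
    constructor
    · rintro ⟨hy, z, hz, rfl⟩
      exact ⟨z, ⟨hz, fun hzΦ => (h.mem_iff z).1 hzΦ hy⟩, rfl⟩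
    · rintro ⟨z, ⟨hz, hzΦ⟩, rfl⟩
      exact ⟨rho_smul_mem_of_not_mem h hzΦ, z, hz, rfl⟩
  rw [h1, h2, Finset.card_image_of_injective _ (MulAction.injective ρ),
    Finset.card_filter_add_card_filter_not]

omit h in
/-- One-term relation: `c·μ(a) = 0` for all `μ ∈ M` with `c ≠ 0` contradicts `o a ≠ 0`. [folklore] -/
theorem false_of_one_term (M : Submodule ℚ (E → ℚ)) (hMa : ∀ μ ∈ M, ∀ x, μ (ρ • x) = -μ x)
    (o : E → V) (ho : ∀ x y, o x = o y ↔ ∀ μ ∈ M, μ x = μ y) (hoρ : ∀ x, o (ρ • x) = -o x)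
    (ho0 : ∀ x, o x ≠ 0) {a : E} {c : ℚ} (hc : c ≠ 0) (hrel : ∀ μ ∈ M, c * μ a = 0) : False := by
  refine apply_ne_neg_apply o ho0 a ?_
  rw [← hoρ, ho]
  intro μ hμ
  have h1 : μ a = 0 := (mul_eq_zero.1 (hrel μ hμ)).resolve_left hc
  rw [hMa μ hμ, h1, neg_zero]

omit h [Module ℚ V] in
/-- Two-term relation: `c·μ(a) + d·μ(b) = 0` for all `μ ∈ M` with `c, d = ±2` gives `o a = ± o b`. [folklore] -/
theorem eq_or_eq_neg_of_two_term (M : Submodule ℚ (E → ℚ)) (hMa : ∀ μ ∈ M, ∀ x, μ (ρ • x) = -μ x)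
    (o : E → V) (ho : ∀ x y, o x = o y ↔ ∀ μ ∈ M, μ x = μ y) (hoρ : ∀ x, o (ρ • x) = -o x)
    {a b : E} {c d : ℚ} (hc : c = 2 ∨ c = -2) (hd : d = 2 ∨ d = -2)
    (hrel : ∀ μ ∈ M, c * μ a + d * μ b = 0) : o a = o b ∨ o a = -o b := by
  rcases hc with rfl | rfl <;> rcases hd with rfl | rfl
  · right; rw [← hoρ, ho]; intro μ hμ; rw [hMa μ hμ]; have := hrel μ hμ; linarith
  · left; rw [ho]; intro μ hμ; have := hrel μ hμ; linarith
  · left; rw [ho]; intro μ hμ; have := hrel μ hμ; linarith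
  · right; rw [← hoρ, ho]; intro μ hμ; rw [hMa μ hμ]; have := hrel μ hμ; linarith


omit h [AddCommGroup V] [Module ℚ V] in
/-- A two-element fibre through `x` is `{x, x'}`. [folklore] -/
theorem exists_partner {S : Finset E} {x : E} (hx : x ∈ S) (h2 : S.card = 2) :
    ∃ x', x ≠ x' ∧ S = {x, x'} := by
  obtain ⟨a, b, hab, rfl⟩ := Finset.card_eq_two.1 h2
  rcases Finset.mem_insert.1 hx with rfl | hx
  · exact ⟨b, hab, rfl⟩
  · rw [Finset.mem_singleton] at hx
    subst hx
    exact ⟨a, hab.symm, Finset.pair_comm a x⟩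

/-- **Contribution of a class of size four to `Σ_Φ μ`**: for a fibre `F(v) = {v, v'}`,
`Σ_{y ∈ F(v) ⊔ F(ρv), y ∈ Φ} μ(y) = (ε(v) + ε(v'))·μ(v)` with `ε = ±1` the sign of membership in `Φ`. [folklore] -/
theorem sum_class_pair (M : Submodule ℚ (E → ℚ)) (hMa : ∀ μ ∈ M, ∀ x, μ (ρ • x) = -μ x) (o : E → V)
    (hoM : ∀ x y, o y = o x → ∀ μ ∈ M, μ y = μ x) (hoρ : ∀ x, o (ρ • x) = -o x) (ho0 : ∀ x, o x ≠ 0)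
    (F : E → Finset E) (hF : ∀ x y, y ∈ F x ↔ o y = o x) {v v' : E} (hvv : v ≠ v') (hFv : F v = {v, v'})
    {μ : E → ℚ} (hμ : μ ∈ M) :
    ∑ y ∈ F v ∪ F (ρ • v), (if y ∈ Φ then μ y else 0) =
      ((if v ∈ Φ then (1 : ℚ) else -1) + (if v' ∈ Φ then 1 else -1)) * μ v := by
  have hv' : μ v' = μ v := hoM v v' ((hF v v').1 (by rw [hFv]; simp)) μ hμ
  have hρv : μ (ρ • v) = -μ v := hMa μ hμ v
  have hρv' : μ (ρ • v') = -μ v := by rw [hMa μ hμ v', hv']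
  have hρ : F (ρ • v) = {ρ • v, ρ • v'} := by
    rw [fibre_rho h o hoρ F hF v, hFv, Finset.image_insert, Finset.image_singleton]
  have hρne : ρ • v ≠ ρ • v' := fun h' => hvv (MulAction.injective ρ h')
  rw [Finset.sum_union (disjoint_fibre_rho o hoρ ho0 F hF v), hFv, hρ, Finset.sum_pair hvv,
    Finset.sum_pair hρne, h.rho_smul_mem_iff, h.rho_smul_mem_iff, hv', hρv, hρv']
  by_cases h1 : v ∈ Φ <;> by_cases h2 : v' ∈ Φ <;> simp [h1, h2] <;> ring

omit [Group G] [MulAction G E] h in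
/-- The sign coefficient of a pair takes the values `−2, 0, 2`, and vanishes iff the pair is MIXED. [folklore] -/
theorem pair_coeff_cases (v v' : E) :
    ((if v ∈ Φ then (1 : ℚ) else -1) + (if v' ∈ Φ then 1 else -1) = 2 ∨
      (if v ∈ Φ then (1 : ℚ) else -1) + (if v' ∈ Φ then 1 else -1) = -2 ∨
      (if v ∈ Φ then (1 : ℚ) else -1) + (if v' ∈ Φ then 1 else -1) = 0) ∧
    (((if v ∈ Φ then (1 : ℚ) else -1) + (if v' ∈ Φ then 1 else -1) = 0) ↔ ¬ (v ∈ Φ ↔ v' ∈ Φ)) := by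
  by_cases h1 : v ∈ Φ <;> by_cases h2 : v' ∈ Φ <;> simp [h1, h2] <;> norm_num

end Values

/-! ### The balanced weights of a mixed pair -/

section Delta

variable [Fintype E]

omit h in
/-- `Σ_y [y = a]·t(y) = t(a)`. [folklore] -/
private theorem sum_ite_eq_mul (a : E) (t : E → ℚ) : ∑ y, (if y = a then (1 : ℚ) else 0) * t y = t a := by
  simp [ite_mul]

/-- **The anti-invariant weight `δ = 𝟙_v + 𝟙_{v'} − 𝟙_{ρv} − 𝟙_{ρv'}` of a pair `{v, v'}` at which every
translate `g⁻¹Φ` is MIXED (`gv ∈ Φ ↔ gv' ∉ Φ`) satisfies Pohlmann's condition.** [cite: Gordon1999HodgeAVSurvey, §9.2 (9.2.1)] -/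
theorem isBalanced_delta (v v' : E) (hmixed : ∀ g : G, ¬ (g • v ∈ Φ ↔ g • v' ∈ Φ)) :
    IsBalanced G Φ fun y => (if y = v then (1 : ℚ) else 0) + (if y = v' then 1 else 0) -
      (if y = ρ • v then 1 else 0) - (if y = ρ • v' then 1 else 0) := by
  intro g
  simp only [add_mul, sub_mul, Finset.sum_add_distrib, Finset.sum_sub_distrib, sum_ite_eq_mul,
    Finset.sum_ite_eq', Finset.mem_univ, if_true, h.translateInd_rho_smul]
  by_cases hv : g • v ∈ Φ
  · have hv' : g • v' ∉ Φ := fun h' => hmixed g ⟨fun _ => h', fun _ => hv⟩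
    rw [translateInd_of_mem hv, translateInd_of_not_mem hv']; norm_num
  · have hv' : g • v' ∈ Φ := by by_contra h'; exact hmixed g ⟨fun h1 => absurd h1 hv, fun h1 => absurd h1 h'⟩
    rw [translateInd_of_not_mem hv, translateInd_of_mem hv']; norm_num

omit [Fintype E] in
/-- `δ` is `ρ`-anti-invariant. [folklore] -/
theorem delta_rho_smul (v v' y : E) :
    (fun y => (if y = v then (1 : ℚ) else 0) + (if y = v' then 1 else 0) -
      (if y = ρ • v then 1 else 0) - (if y = ρ • v' then 1 else 0)) (ρ • y) =
    -(fun y => (if y = v then (1 : ℚ) else 0) + (if y = v' then 1 else 0) -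
      (if y = ρ • v then 1 else 0) - (if y = ρ • v' then 1 else 0)) y := by
  have e : ∀ a : E, (ρ • y = a ↔ y = ρ • a) := fun a =>
    ⟨fun h1 => by rw [← h1, h.invol], fun h1 => by rw [h1, h.invol]⟩
  have e' : ∀ a : E, (ρ • y = ρ • a ↔ y = a) := fun a => (MulAction.injective ρ).eq_iff
  simp only [e', e]
  ring


omit h [Fintype E] in
/-- `δ` vanishes off `{v, v', ρv, ρv'}`. [folklore] -/
private theorem delta_apply_eq_zero {v v' y : E} (hy : y ∉ ({v, v', ρ • v, ρ • v'} : Finset E)) :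
    (fun y => (if y = v then (1 : ℚ) else 0) + (if y = v' then 1 else 0) -
      (if y = ρ • v then 1 else 0) - (if y = ρ • v' then 1 else 0)) y = 0 := by
  simp only [Finset.mem_insert, Finset.mem_singleton, not_or] at hy
  simp [hy.1, hy.2.1, hy.2.2.1, hy.2.2.2]

omit h in
/-- `δ`'s of disjoint classes are orthogonal. [folklore] -/
theorem dotProduct_delta_eq_zero {v v' u u' : E}
    (hdisj : Disjoint ({v, v', ρ • v, ρ • v'} : Finset E) {u, u', ρ • u, ρ • u'}) :
    dotProduct (fun y => (if y = v then (1 : ℚ) else 0) + (if y = v' then 1 else 0) -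
        (if y = ρ • v then 1 else 0) - (if y = ρ • v' then 1 else 0))
      (fun y => (if y = u then (1 : ℚ) else 0) + (if y = u' then 1 else 0) -
        (if y = ρ • u then 1 else 0) - (if y = ρ • u' then 1 else 0)) = 0 := by
  unfold dotProduct
  refine Finset.sum_eq_zero fun y _ => ?_
  by_cases hy : y ∈ ({v, v', ρ • v, ρ • v'} : Finset E)
  · have hy' : y ∉ ({u, u', ρ • u, ρ • u'} : Finset E) := Finset.disjoint_left.1 hdisj hy
    rw [delta_apply_eq_zero (ρ := ρ) hy', mul_zero]
  · rw [delta_apply_eq_zero (ρ := ρ) hy, zero_mul]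

omit h [Fintype E] in
/-- `δ(v) = 1`, so `δ ≠ 0`. [folklore] -/
theorem delta_ne_zero {v v' : E} (h1 : v ≠ v') (h2 : v ≠ ρ • v) (h3 : v ≠ ρ • v') :
    (fun y => (if y = v then (1 : ℚ) else 0) + (if y = v' then 1 else 0) -
      (if y = ρ • v then 1 else 0) - (if y = ρ • v' then 1 else 0)) ≠ 0 := by
  intro h0
  have := congr_fun h0 v
  simp [h1, h2, h3] at this

end Delta

/-! ### The non-separating case -/

section NonSeparating

variable {V : Type*} [AddCommGroup V] [Module ℚ V]

/-- **Two classes of size six force `dim M ≤ 1`**: with `F(x₁), ρF(x₁), F(z), ρF(z)` of size `3` each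
exhausting `E`, `Σ_Φ μ = (a − a')μ(x₁) + (b − b')μ(z)` with `a + a' = 3 = b + b'`, so `μ(z)` is a fixed multiple
of `μ(x₁)` and `μ ↦ μ(x₁)` is injective on `M`. [folklore] -/
theorem finrank_le_one_of_card_fibre_eq_three [Fintype E] (M : Submodule ℚ (E → ℚ))
    (hMa : ∀ μ ∈ M, ∀ x, μ (ρ • x) = -μ x) (o : E → V) (hoM : ∀ x y, o y = o x → ∀ μ ∈ M, μ y = μ x)
    (hoρ : ∀ x, o (ρ • x) = -o x) (ho0 : ∀ x, o x ≠ 0) (F : E → Finset E)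
    (hF : ∀ x y, y ∈ F x ↔ o y = o x) (hcard : Fintype.card E = 12)
    (hΦnull : ∀ μ ∈ M, ∑ y ∈ Finset.univ.filter (fun y : E => y ∈ Φ), μ y = 0)
    {x₁ z : E} (hz : o z ≠ o x₁) (hz' : o z ≠ -o x₁) (hs : (F x₁).card = 3) (hsz : (F z).card = 3) :
    Module.finrank ℚ M ≤ 1 := by
  have ha := card_inter_fibre_add h o hoρ F hF x₁
  have hb := card_inter_fibre_add h o hoρ F hF z
  rw [hs] at ha
  rw [hsz] at hb
  set Φf := Finset.univ.filter (fun y : E => y ∈ Φ) with hΦf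
  have hdisj : Disjoint (F z ∪ F (ρ • z)) (F x₁ ∪ F (ρ • x₁)) := disjoint_union_fibre o hoρ F hF hz hz'
  have huniv : (F z ∪ F (ρ • z)) ∪ (F x₁ ∪ F (ρ • x₁)) = Finset.univ :=
    Finset.eq_univ_of_card _ (by
      rw [Finset.card_union_of_disjoint hdisj, card_union_fibre h o hoρ ho0 F hF,
        card_union_fibre h o hoρ ho0 F hF, hs, hsz, hcard])
  have hrel : ∀ μ ∈ M, (((Φf ∩ F x₁).card : ℚ) - (Φf ∩ F (ρ • x₁)).card) * μ x₁ +
      (((Φf ∩ F z).card : ℚ) - (Φf ∩ F (ρ • z)).card) * μ z = 0 := by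
    intro μ hμ
    have h0 := hΦnull μ hμ
    have hsplit : Φf = ((Φf ∩ F z) ∪ (Φf ∩ F (ρ • z))) ∪ ((Φf ∩ F x₁) ∪ (Φf ∩ F (ρ • x₁))) := by
      rw [← Finset.inter_union_distrib_left, ← Finset.inter_union_distrib_left,
        ← Finset.inter_union_distrib_left, huniv, Finset.inter_univ]
    have hd1 : Disjoint (Φf ∩ F z) (Φf ∩ F (ρ • z)) :=
      (disjoint_fibre_rho o hoρ ho0 F hF z).mono Finset.inter_subset_right Finset.inter_subset_right
    have hd2 : Disjoint (Φf ∩ F x₁) (Φf ∩ F (ρ • x₁)) :=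
      (disjoint_fibre_rho o hoρ ho0 F hF x₁).mono Finset.inter_subset_right Finset.inter_subset_right
    have hd3 : Disjoint ((Φf ∩ F z) ∪ (Φf ∩ F (ρ • z))) ((Φf ∩ F x₁) ∪ (Φf ∩ F (ρ • x₁))) :=
      hdisj.mono (Finset.union_subset_union Finset.inter_subset_right Finset.inter_subset_right)
        (Finset.union_subset_union Finset.inter_subset_right Finset.inter_subset_right)
    rw [hsplit, Finset.sum_union hd3, Finset.sum_union hd1, Finset.sum_union hd2,
      sum_inter_fibre M o hoM F hF Φf z hμ, sum_inter_fibre M o hoM F hF Φf (ρ • z) hμ,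
      sum_inter_fibre M o hoM F hF Φf x₁ hμ, sum_inter_fibre M o hoM F hF Φf (ρ • x₁) hμ,
      hMa μ hμ z, hMa μ hμ x₁] at h0
    linarith
  have hbb : (((Φf ∩ F z).card : ℚ) - (Φf ∩ F (ρ • z)).card) ≠ 0 := by
    intro h'
    have h'' : ((Φf ∩ F z).card : ℚ) = (Φf ∩ F (ρ • z)).card := by linarith
    norm_cast at h''
    omega
  have hinj : Function.Injective ((LinearMap.proj x₁ : (E → ℚ) →ₗ[ℚ] ℚ) ∘ₗ M.subtype) := by
    rw [injective_iff_map_eq_zero]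
    rintro ⟨μ, hμ⟩ hμ0
    change μ x₁ = 0 at hμ0
    have hμz : μ z = 0 := by
      have h1 := hrel μ hμ
      rw [hμ0, mul_zero, zero_add] at h1
      exact (mul_eq_zero.1 h1).resolve_left hbb
    apply Subtype.ext
    funext y
    have hy : y ∈ (F z ∪ F (ρ • z)) ∪ (F x₁ ∪ F (ρ • x₁)) := huniv ▸ Finset.mem_univ y
    rw [Finset.mem_union, mem_union_fibre_iff o hoρ F hF, mem_union_fibre_iff o hoρ F hF] at hy
    show μ y = 0
    rcases hy with (hy | hy) | (hy | hy)
    · rw [hoM z y hy μ hμ, hμz]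
    · rw [hoM (ρ • z) y (by rw [hoρ]; exact hy) μ hμ, hMa μ hμ, hμz, neg_zero]
    · rw [hoM x₁ y hy μ hμ, hμ0]
    · rw [hoM (ρ • x₁) y (by rw [hoρ]; exact hy) μ hμ, hMa μ hμ, hμ0, neg_zero]
  have := LinearMap.finrank_le_finrank_of_injective hinj
  rwa [Module.finrank_self] at this

omit h [Module ℚ V] in
/-- **One class forces `dim M ≤ 1`**: every `μ ∈ M` is `± μ(x₁)` everywhere. [folklore] -/
theorem finrank_le_one_of_union_fibre_eq_univ [Fintype E] (M : Submodule ℚ (E → ℚ))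
    (hMa : ∀ μ ∈ M, ∀ x, μ (ρ • x) = -μ x) (o : E → V) (hoM : ∀ x y, o y = o x → ∀ μ ∈ M, μ y = μ x)
    (hoρ : ∀ x, o (ρ • x) = -o x) (F : E → Finset E) (hF : ∀ x y, y ∈ F x ↔ o y = o x) {x₁ : E}
    (hC : F x₁ ∪ F (ρ • x₁) = Finset.univ) : Module.finrank ℚ M ≤ 1 := by
  have hinj : Function.Injective ((LinearMap.proj x₁ : (E → ℚ) →ₗ[ℚ] ℚ) ∘ₗ M.subtype) := by
    rw [injective_iff_map_eq_zero]
    rintro ⟨μ, hμ⟩ hμ0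
    change μ x₁ = 0 at hμ0
    apply Subtype.ext
    funext y
    have hy : y ∈ F x₁ ∪ F (ρ • x₁) := hC ▸ Finset.mem_univ y
    rw [mem_union_fibre_iff o hoρ F hF] at hy
    show μ y = 0
    rcases hy with hy | hy
    · rw [hoM x₁ y hy μ hμ, hμ0]
    · rw [hoM (ρ • x₁) y (by rw [hoρ]; exact hy) μ hμ, hMa μ hμ, hμ0, neg_zero]
  have := LinearMap.finrank_le_finrank_of_injective hinj
  rwa [Module.finrank_self] at this

end NonSeparating

end Summit.HodgeConjecture.CorCM.CMSixfoldRank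

end
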